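import Summits.ValiantsHypothesis.ValiantsHypothesis.Theorems.LacunarySymmetroidMatrixDescartesFiniteSectorPairSumMasks

/-!
# `MatrixDescartes` — line «finite»: ITERATED SHIFT-OR MASKS (kernel-fast form of the `m`-fold sum masks), generic in `m`

HONEST FRAMING.  Object-search cell `pub-symmetroid`, seat val-sym-door-p5 g11.  HELPER of the crux item `stmt-ValiantsHypothesis-18050`
(`Theses.LacunarySymmetroid.MatrixDescartes`) with NO closure claim and no statement about pencils: pure bit bookkeeping, GENERIC in the number
of summands `m`, for the finite cores of the sector / stamp ceilings of line «finite» (`HypRootLawAt`, `StampLawAt`).  The `m`-fold sum mask of a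
value list `l` is written as the `m`-th ITERATE `(F l)^[m] 1` of the one-more-summand step
`F l = fun E => List.rec 0 (fun x _ acc => Nat.lor acc (Nat.shiftLeft E x)) l` (raw recursor + GMP-backed `Nat.lor` / `Nat.shiftLeft`: the kernel
evaluates it ≈ 20× faster than the `List.foldr (· ||| · * 2 ^ ·)` form of `…FiniteSectorSumMasksHigher*`, and its lower iterates are shared by the
kernel's structural cache); the mask of `l ++ [c]` is written INCREMENTALLY from the masks of `l`
(`Nat.rec 1 (fun k acc => Nat.lor ((F l)^[k+1] 1) (Nat.shiftLeft acc c)) m`); the children of a prefix in the pruned enumeration are the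
`List.takeWhile` of an interval (the cover / alive guards are monotone in the candidate).  Lemmas: membership ⇒ bit for both forms
(`testBit_iterMask_of_multiset`, `testBit_incMask_of_multiset`), the prefix rule in multiset form, the `takeWhile` membership rules, and the
capped-multiset reading of the census sum set.  Nothing here bears on the crux, the doors, or `VP ≠ VNP`.
[folklore] Elementary bit arithmetic; no citation is load-bearing.
-/

-- `Summit.ValiantsHypothesis.ValiantsHypothesis.…` repeats a component by the D-0017 layout
-- (single-conjunct summit), which the `dupNamespace` linter flags; the name is mandated.
set_option linter.dupNamespace false

namespace Summit.ValiantsHypothesis.ValiantsHypothesis.Theorems.LacunarySymmetroidMatrixDescartes.FiniteSector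

/-! ## The shift-or step and its iterates -/

/-- One shift-or step: if bit `r` of `E` is set and `x ∈ l` then bit `r + x` of `List.rec 0 (fun x _ acc => acc ||| (E <<< x)) l` is set. [folklore] -/
theorem testBit_shiftStep_of_mem {l : List ℕ} {E r x : ℕ} (hx : x ∈ l) (hE : E.testBit r = true) :
    (@List.rec ℕ (fun _ => ℕ) 0 (fun (x : ℕ) (_ : List ℕ) (acc : ℕ) => Nat.lor acc (Nat.shiftLeft E x)) l).testBit (r + x) = true := by
  induction l with
  | nil => simp at hx
  | cons y l ih =>
    show (Nat.lor (@List.rec ℕ (fun _ => ℕ) 0 (fun (x : ℕ) (_ : List ℕ) (acc : ℕ) => Nat.lor acc (Nat.shiftLeft E x)) l)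
      (Nat.shiftLeft E y)).testBit (r + x) = true
    have e1 : ∀ a b : ℕ, Nat.lor a b = a ||| b := fun _ _ => rfl
    have e2 : ∀ a b : ℕ, Nat.shiftLeft a b = a <<< b := fun _ _ => rfl
    rw [e1, e2, Nat.testBit_lor]
    rcases List.mem_cons.mp hx with rfl | hx'
    · rw [Nat.testBit_shiftLeft]
      simp [hE]
    · rw [ih hx']
      simp

/-- **Membership ⇒ bit, iterated form.**  If `t` is a multiset of elements of `l` then bit `t.sum` of the `card t`-th iterate
`(F l)^[card t] 1` of the shift-or step is set (`r` is a `card t`-fold sum of elements of `l`). [folklore] -/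
theorem testBit_iterMask_of_multiset (l : List ℕ) (t : Multiset ℕ) (ht : ∀ x ∈ t, x ∈ l) :
    ((fun (E : ℕ) => @List.rec ℕ (fun _ => ℕ) 0 (fun (x : ℕ) (_ : List ℕ) (acc : ℕ) => Nat.lor acc (Nat.shiftLeft E x)) l)^[Multiset.card t] 1).testBit
      t.sum = true := by
  induction t using Multiset.induction_on with
  | empty => simp
  | cons y t ih =>
    rw [Multiset.card_cons, Function.iterate_succ_apply', Multiset.sum_cons, add_comm]
    exact testBit_shiftStep_of_mem (ht y (Multiset.mem_cons_self _ _)) (ih fun x hx => ht x (Multiset.mem_cons_of_mem hx))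

/-- Same, with the number of summands named: `card t = m`. [folklore] -/
theorem testBit_iterMask_of_multiset' (l : List ℕ) (m : ℕ) (t : Multiset ℕ) (ht : ∀ x ∈ t, x ∈ l) (hm : Multiset.card t = m) :
    ((fun (E : ℕ) => @List.rec ℕ (fun _ => ℕ) 0 (fun (x : ℕ) (_ : List ℕ) (acc : ℕ) => Nat.lor acc (Nat.shiftLeft E x)) l)^[m] 1).testBit
      t.sum = true := by
  subst hm
  exact testBit_iterMask_of_multiset l t ht

/-- **Membership ⇒ bit, incremental form** (core induction): `t` over `l` and `i` extra copies of `c`. [folklore] -/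
theorem testBit_incMask_aux (l : List ℕ) (c : ℕ) (t : Multiset ℕ) (ht : ∀ x ∈ t, x ∈ l) (i : ℕ) :
    (@Nat.rec (fun _ => ℕ) 1 (fun (k acc : ℕ) => Nat.lor
      ((fun (E : ℕ) => @List.rec ℕ (fun _ => ℕ) 0 (fun (x : ℕ) (_ : List ℕ) (acc : ℕ) => Nat.lor acc (Nat.shiftLeft E x)) l)^[k + 1] 1)
      (Nat.shiftLeft acc c)) (Multiset.card t + i)).testBit (t.sum + i * c) = true := by
  have e1 : ∀ a b : ℕ, Nat.lor a b = a ||| b := fun _ _ => rfl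
  have e2 : ∀ a b : ℕ, Nat.shiftLeft a b = a <<< b := fun _ _ => rfl
  induction i with
  | zero =>
    rw [Nat.add_zero, Nat.zero_mul, Nat.add_zero]
    have hb := testBit_iterMask_of_multiset l t ht
    rcases h : Multiset.card t with _ | k
    · rw [h] at hb
      simpa using hb
    · rw [h] at hb
      show (Nat.lor ((fun (E : ℕ) => @List.rec ℕ (fun _ => ℕ) 0 (fun (x : ℕ) (_ : List ℕ) (acc : ℕ) =>
        Nat.lor acc (Nat.shiftLeft E x)) l)^[k + 1] 1) _).testBit t.sum = true
      rw [e1, Nat.testBit_lor, hb]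
      simp
  | succ i ih =>
    rw [← Nat.add_assoc]
    show (Nat.lor _ (Nat.shiftLeft (@Nat.rec (fun _ => ℕ) 1 (fun (k acc : ℕ) => Nat.lor
      ((fun (E : ℕ) => @List.rec ℕ (fun _ => ℕ) 0 (fun (x : ℕ) (_ : List ℕ) (acc : ℕ) => Nat.lor acc (Nat.shiftLeft E x)) l)^[k + 1] 1)
      (Nat.shiftLeft acc c)) (Multiset.card t + i)) c)).testBit (t.sum + (i + 1) * c) = true
    rw [Nat.add_mul, Nat.one_mul, ← Nat.add_assoc, e1, e2, Nat.testBit_lor, Nat.testBit_shiftLeft, Nat.add_sub_cancel, ih]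
    simp

/-- **Membership ⇒ bit, incremental form.**  If `t` is a multiset over `l ++ [c]` with `card t = m` then bit `t.sum` of the incremental
mask `Nat.rec 1 (fun k acc => ((F l)^[k+1] 1) ||| (acc <<< c)) m` of `l ++ [c]` is set. [folklore] -/
theorem testBit_incMask_of_multiset (l : List ℕ) (c m : ℕ) (t : Multiset ℕ) (ht : ∀ x ∈ t, x ∈ l ++ [c])
    (hm : Multiset.card t = m) :
    (@Nat.rec (fun _ => ℕ) 1 (fun (k acc : ℕ) => Nat.lor
      ((fun (E : ℕ) => @List.rec ℕ (fun _ => ℕ) 0 (fun (x : ℕ) (_ : List ℕ) (acc : ℕ) => Nat.lor acc (Nat.shiftLeft E x)) l)^[k + 1] 1)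
      (Nat.shiftLeft acc c)) m).testBit t.sum = true := by
  classical
  set t₁ := t.filter (· ≠ c) with ht₁
  set i := t.count c with hi
  have hsplit : t = t₁ + Multiset.replicate i c := by
    have h1 : Multiset.filter (fun x => ¬ (x ≠ c)) t = Multiset.replicate i c := by
      rw [hi, ← Multiset.filter_eq']
      exact Multiset.filter_congr fun x _ => by simp
    rw [ht₁, ← h1]
    exact (Multiset.filter_add_not _ t).symm
  have ht₁l : ∀ x ∈ t₁, x ∈ l := by
    intro x hx
    rw [ht₁, Multiset.mem_filter] at hx
    rcases List.mem_append.mp (ht x hx.1) with h | h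
    · exact h
    · exact absurd (List.mem_singleton.mp h) hx.2
  have hcard : m = Multiset.card t₁ + i := by
    rw [← hm, hsplit, Multiset.card_add, Multiset.card_replicate]
  have hsum : t.sum = t₁.sum + i * c := by
    rw [hsplit, Multiset.sum_add, Multiset.sum_replicate, smul_eq_mul]
  rw [hcard, hsum]
  exact testBit_incMask_aux l c t₁ ht₁l i

/-! ## The prefix rule and the census sum set, multiset form -/

/-- **Prefix rule.**  A multiset over `l₁ ++ l₂` whose sum is `< x ≤ min l₂` lies over `l₁`. [folklore] -/
theorem multiset_prefix {l₁ l₂ : List ℕ} {x : ℕ} {t : Multiset ℕ} (hx : ∀ y ∈ l₂, x ≤ y) (hr : t.sum < x)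
    (ht : ∀ y ∈ t, y ∈ l₁ ++ l₂) : ∀ y ∈ t, y ∈ l₁ := by
  intro y hy
  rcases List.mem_append.mp (ht y hy) with h | h
  · exact h
  · exfalso
    have h1 := hx y h
    have h2 : y ≤ t.sum := Multiset.le_sum_of_mem hy
    omega

/-- **Census sum set ⇒ capped multiset.**  An `m`-fold sum `r < cap` of exponents `d i` (the census currency
`image (fun s : Sym (Fin K) m => (s.map d).sum)`) is the sum of a multiset of `m` CAPPED values `min (d i) cap`, all in any list `L` containing them. [folklore] -/
theorem exists_multiset_of_mem_sumset {K m : ℕ} (d : Fin K → ℕ) (cap : ℕ) (L : List ℕ) (hL : ∀ i, min (d i) cap ∈ L)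
    {r : ℕ} (hr : r < cap)
    (h : r ∈ (Finset.univ : Finset (Sym (Fin K) m)).image (fun s : Sym (Fin K) m => ((s : Multiset (Fin K)).map d).sum)) :
    ∃ t : Multiset ℕ, (∀ x ∈ t, x ∈ L) ∧ Multiset.card t = m ∧ t.sum = r := by
  rw [Finset.mem_image] at h
  obtain ⟨s, -, hs⟩ := h
  refine ⟨(s : Multiset (Fin K)).map (fun i => min (d i) cap), ?_, ?_, ?_⟩
  · intro x hx
    rw [Multiset.mem_map] at hx
    obtain ⟨i, -, rfl⟩ := hx
    exact hL i
  · rw [Multiset.card_map]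
    exact s.2
  · rw [← hs]
    congr 1
    apply Multiset.map_congr rfl
    intro i hi
    have : d i ≤ ((s : Multiset (Fin K)).map d).sum := Multiset.le_sum_of_mem (Multiset.mem_map_of_mem d hi)
    exact Nat.min_eq_left (by omega)

/-- If `0` is an `m`-fold sum of exponents (`m ≠ 0`) then some capped exponent `min (d i) cap` is `0` (`0 < cap`). [folklore] -/
theorem exists_index_eq_zero {K m : ℕ} (d : Fin K → ℕ) (cap : ℕ) (hm : m ≠ 0) (hcap : 0 < cap)
    (h : 0 ∈ (Finset.univ : Finset (Sym (Fin K) m)).image (fun s : Sym (Fin K) m => ((s : Multiset (Fin K)).map d).sum)) :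
    ∃ i, min (d i) cap = 0 := by
  obtain ⟨t, ht, hcard, hsum⟩ := exists_multiset_of_mem_sumset d cap ((List.finRange K).map (fun i => min (d i) cap))
    (fun i => List.mem_map.mpr ⟨i, List.mem_finRange i, rfl⟩) hcap h
  have hne : t ≠ 0 := by
    intro h0
    rw [h0, Multiset.card_zero] at hcard
    exact hm hcard.symm
  obtain ⟨x, hx⟩ := Multiset.exists_mem_of_ne_zero hne
  have hx0 : x = 0 := by
    have := Multiset.le_sum_of_mem hx
    omega
  obtain ⟨i, -, hi⟩ := List.mem_map.mp (ht x hx)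
  exact ⟨i, hi.trans hx0⟩

/-- If `1` is an `m`-fold sum of exponents then some capped exponent `min (d i) cap` is `1` (`1 < cap`). [folklore] -/
theorem exists_index_eq_one {K m : ℕ} (d : Fin K → ℕ) (cap : ℕ) (hcap : 1 < cap)
    (h : 1 ∈ (Finset.univ : Finset (Sym (Fin K) m)).image (fun s : Sym (Fin K) m => ((s : Multiset (Fin K)).map d).sum)) :
    ∃ i, min (d i) cap = 1 := by
  obtain ⟨t, ht, hcard, hsum⟩ := exists_multiset_of_mem_sumset d cap ((List.finRange K).map (fun i => min (d i) cap))
    (fun i => List.mem_map.mpr ⟨i, List.mem_finRange i, rfl⟩) hcap h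
  have hex : ∃ x ∈ t, x ≠ 0 := by
    by_contra hall
    push Not at hall
    have := Multiset.sum_eq_zero hall
    omega
  obtain ⟨x, hx, hx0⟩ := hex
  have hx1 : x = 1 := by
    have := Multiset.le_sum_of_mem hx
    omega
  obtain ⟨i, -, hi⟩ := List.mem_map.mp (ht x hx)
  exact ⟨i, hi.trans hx1⟩

/-! ## Children of a prefix = `takeWhile` of an interval -/

/-- If `p` holds at every `c' ∈ [s, c]` and `c < e` then `c ∈ (List.Ico s e).takeWhile p`. [folklore] -/
theorem mem_takeWhile_Ico {p : ℕ → Bool} {s e c : ℕ} (hs : s ≤ c) (he : c < e)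
    (h : ∀ c', s ≤ c' → c' ≤ c → p c' = true) : c ∈ (List.Ico s e).takeWhile p := by
  have key : ∀ n s, s ≤ c → c < s + n → (∀ c', s ≤ c' → c' ≤ c → p c' = true) → c ∈ (List.range' s n).takeWhile p := by
    intro n
    induction n with
    | zero => intro s hs he; omega
    | succ n ih =>
      intro s hs he h
      rw [List.range'_succ, List.takeWhile_cons, if_pos (h s le_rfl hs)]
      rcases Nat.eq_or_lt_of_le hs with rfl | hlt
      · exact List.mem_cons_self
      · exact List.mem_cons_of_mem _ (ih (s + 1) hlt (by omega) fun c' h1 h2 => h c' (by omega) h2)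
  exact key (e - s) s hs (by omega) h

/-- **Cover children.**  If the prefix mask `Mp` covers `[0, min T c)`, `lo < c < C ≤ T + 1`, then `c` passes the cover `takeWhile`. [folklore] -/
theorem mem_takeWhile_cover {Mp lo c C T : ℕ} (hlo : lo < c) (hcC : c < C) (hCT : C ≤ T + 1)
    (hcov : ∀ r < min T c, Mp.testBit r = true) :
    c ∈ (List.Ico (lo + 1) C).takeWhile (fun c => Nat.testBit Mp (c - 1)) :=
  mem_takeWhile_Ico hlo hcC fun c' h1 h2 => hcov (c' - 1) (by
    have : c' - 1 < c := by omega
    have : c' - 1 < T := by omega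
    exact lt_min ‹_› ‹c' - 1 < c›)

/-- **Alive children.**  If bit `0` of the prefix mask `Mp` is set and its step-≤-2 chain is alive below `min T (c - 1)`, `lo < c < C`, then `c`
passes the alive `takeWhile` (predicate `T + 2 ≤ c ∨ bit (c-2) of Mp ||| Mp/2`). [folklore] -/
theorem mem_takeWhile_alive {Mp lo c C T : ℕ} (hlo : lo < c) (hcC : c < C) (h0 : Mp.testBit 0 = true)
    (halive : ∀ r < min T (c - 1), Mp.testBit r = true ∨ Mp.testBit (r + 1) = true) :
    c ∈ (List.Ico (lo + 1) C).takeWhile (fun c => decide (T + 2 ≤ c) || Nat.testBit (Nat.lor Mp (Mp / 2)) (c - 2)) := by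
  apply mem_takeWhile_Ico hlo hcC
  intro c' h1 h2
  rw [Bool.or_eq_true_iff]
  by_cases hT : T + 2 ≤ c'
  · exact Or.inl (decide_eq_true hT)
  · right
    have e1 : ∀ a b : ℕ, Nat.lor a b = a ||| b := fun _ _ => rfl
    rw [e1, Nat.testBit_lor, Bool.or_eq_true_iff, ← Nat.testBit_succ, Nat.succ_eq_add_one]
    by_cases hc' : c' ≤ 2
    · have : c' - 2 = 0 := by omega
      rw [this]
      exact Or.inl h0
    · exact halive (c' - 2) (by
        have : c' - 2 < c - 1 := by omega
        have : c' - 2 < T := by omega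
        exact lt_min ‹_› ‹c' - 2 < c - 1›) |>.imp id (fun h => by
          have : c' - 2 + 1 = c' - 2 + 1 := rfl
          exact h)

/-! ## Bits ⇒ the cover / alive equations in `Nat.lor` form -/

/-- `Nat.lor` spelling of `maskAlive_of_testBit`. [folklore] -/
theorem maskAlive_of_testBit' {P t : ℕ} (h : ∀ r < t, P.testBit r = true ∨ P.testBit (r + 1) = true) :
    Nat.lor P (P / 2) % 2 ^ t = 2 ^ t - 1 :=
  maskAlive_of_testBit h

end Summit.ValiantsHypothesis.ValiantsHypothesis.Theorems.LacunarySymmetroidMatrixDescartes.FiniteSector
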